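import Summits.QuantumFields.YangMills.Theorems.DiagonalMirrorRPRWilsonDiagonalModelChainTonelli
import Summits.QuantumFields.YangMills.Theorems.DiagonalMirrorRPRWilsonDiagonalModelAbsResum

/-!
# Crux `DiagonalMirrorRPR` (stmt-QuantumFields-10604), line `sign-twisted-diagonal-trace`, construction F1_diag
# (director-ym O4 WORD 3 (A)), S4d₂: `Tr K_u^m = Σ'_{k ∈ ℕ^{ℤ_m}} ∫ ∏_t chainFactor k P t dP` — the dominated interchange

Helper for the crux `DiagonalMirrorRPR` of `YangMills` (routes `IsotropyFromPowerCounting`, `MirrorModularBoosts`,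
`PencilRigidity`; item stmt-QuantumFields-10604), attached `--supports … --as helper`; it closes nothing by itself.
Continuation of `…ChainTonelli` (`diagCyclicTraceU_eq_integral_tsum`) and `…AbsResum` (`hasSum_abs_natFeature_mul`).

* `exists_hasSum_abs_prod_chainFactor_le` — `Σ_k |∏_t chainFactor k P t| ≤ B` uniformly in the chain configuration `P` (compactness);
* `measurable_chainFactor`;
* ★ **`diagCyclicTraceU_eq_tsum_integral`** — `diagCyclicTraceU ρ β m = Σ'_{k} ∫ ∏_t chainFactor ρ β k P t d(halfHaar ⊗ halfHaar)^{ℤ_m}`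
  (`MeasureTheory.integral_tsum` with the bound above).

OWED (last step of S4d): the `Y`-integrations inside `∫ ∏_t chainFactor k P t dP` produce `∫_X ∏_t 𝔞((k_t, X_t), (k_{t+1}, X_{t+1}))`
(`natKernel`), i.e. `Tr K_u^m =` the cyclic `m`-fold integral of the lifted kernel over `(count ⊗ halfHaar)^m`; then the spectral side (S4e),
(S5), (P).  HONEST FRAMING: construction helper; no `def wilsonDiagonalModel`; nothing about D_old ⟨10604⟩, the RP crux of the FOLD
restate, or the summit is proved; the Yang–Mills mass gap is NOT proved here or anywhere in the tree.
-/

set_option autoImplicit false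

noncomputable section

open scoped BigOperators ENNReal
open MeasureTheory
open Literature.MathematicalPhysics.QuantumLattice Literature.MathematicalPhysics.QuantumFieldTheory
open Summit.QuantumFields.YangMills.Cruxes.DiagonalMirrorRPR.ParityBridgeColdTraces

namespace Summit.QuantumFields.YangMills.Cruxes.DiagonalMirrorRPR.SignTwistedDiagonalTrace.WilsonDiagonal

/-! ## §27 `Tr K_u^m = Σ'_{k ∈ ℕ^{ℤ_m}} ∫ ∏_t chainFactor k P t dP` (dominated interchange) -/

section ChainFubini

variable {S : ℕ} [NeZero S] {G : Type} [Group G] {Nc : ℕ} (ρ : G →* Matrix (Fin Nc) (Fin Nc) ℂ)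
variable [TopologicalSpace G] [IsTopologicalGroup G] [CompactSpace G] [MeasurableSpace G] [BorelSpace G]
  [SecondCountableTopology G]

omit [MeasurableSpace G] [BorelSpace G] [SecondCountableTopology G] in
/-- The absolute chain factors are uniformly summable over the multi-index: `Σ_k |∏_t chainFactor k P t| ≤ B` for all `P`. -/
theorem exists_hasSum_abs_prod_chainFactor_le (hρ : Continuous ρ) {β : ℝ} (hβ : 0 ≤ β) (m : ℕ) [NeZero m] :
    ∃ B : ℝ, ∀ P : ZMod m → HalfCfg S S G × HalfCfg S S G, ∃ s : ℝ,
      HasSum (fun k : ZMod m → ℕ => |∏ t, chainFactor ρ β k P t|) s ∧ s ≤ B := by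
  obtain ⟨Co, hCo, hodd⟩ := exists_exp_oddActionU_le (S := S) ρ hρ β
  obtain ⟨Ci, hCi, hins⟩ := exists_exp_inslabAction_le (S := S) ρ hρ (2 * β)
  obtain ⟨M, hM⟩ := exists_abs_bondVec_le (S := S) (Nc := Nc) ρ hρ
  have hins' : ∀ X : HalfCfg S S G, Real.exp (β * inslabAction ρ X) ≤ Ci := fun X => by
    have := hins X; rwa [show 2 * β / 2 = β by ring] at this
  set E : ℝ := Real.exp (β * (featDim S Nc * M ^ 2)) with hE
  refine ⟨∏ _t : ZMod m, Ci * E * Co, fun P => ?_⟩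
  -- per-factor absolute sums
  have hfac : ∀ t : ZMod m, HasSum (fun k : ℕ => |chainFactor ρ β (fun _ => k) P t|)
      (Real.exp (β * inslabAction ρ (P t).2) *
        Real.exp (β * ∑ j, |bondVec ρ (thetaHalf (P (t + 1)).1) j| * |bondVec ρ (P t).1 j|) *
        Real.exp (β * oddActionU ρ (P t).2 (P (t + 1)).1 (P (t + 1)).2)) := by
    intro t
    have h := ((hasSum_abs_natFeature_mul hβ (bondVec ρ (thetaHalf (P (t + 1)).1)) (bondVec ρ (P t).1)).mul_left
      (Real.exp (β * inslabAction ρ (P t).2))).mul_right (Real.exp (β * oddActionU ρ (P t).2 (P (t + 1)).1 (P (t + 1)).2))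
    refine h.congr_fun fun k => ?_
    simp only [chainFactor, abs_mul, abs_of_pos (Real.exp_pos _)]
  -- the product over `t`
  have hprod := hasSum_pi_prod_fintype (ι := ZMod m)
    (f := fun t k => |chainFactor ρ β (fun _ => k) P t|) (fun t => hfac t)
    (fun t => by simpa only [Real.norm_eq_abs, abs_abs] using (hfac t).summable)
  have hkey : (fun k : ZMod m → ℕ => ∏ t, |chainFactor ρ β (fun _ => k t) P t|) =
      fun k => |∏ t, chainFactor ρ β k P t| := by
    funext k
    rw [Finset.abs_prod]
    rfl
  rw [hkey] at hprod
  refine ⟨_, hprod, Finset.prod_le_prod (fun t _ => by positivity) fun t _ => ?_⟩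
  have h2 : Real.exp (β * ∑ j, |bondVec ρ (thetaHalf (P (t + 1)).1) j| * |bondVec ρ (P t).1 j|) ≤ E := by
    rw [← (hasSum_abs_natFeature_mul hβ _ _).tsum_eq, hE]
    exact tsum_abs_natFeature_mul_le hβ (fun j => hM _ j) (fun j => hM _ j)
  exact mul_le_mul (mul_le_mul (hins' _) h2 (Real.exp_pos _).le hCi.le) (hodd _ _ _) (Real.exp_pos _).le (by positivity)

omit [CompactSpace G] in
/-- Each chain factor is measurable in the chain configuration (composition of continuous maps on half layers with coordinate
projections). -/
theorem measurable_chainFactor (hρ : Continuous ρ) (β : ℝ) {m : ℕ} (k : ZMod m → ℕ) (t : ZMod m) :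
    Measurable fun P : ZMod m → HalfCfg S S G × HalfCfg S S G => chainFactor ρ β k P t := by
  have hm1 : ∀ s : ZMod m, Measurable fun P : ZMod m → HalfCfg S S G × HalfCfg S S G => (P s).1 := fun s =>
    measurable_fst.comp (measurable_pi_apply s)
  have hm2 : ∀ s : ZMod m, Measurable fun P : ZMod m → HalfCfg S S G × HalfCfg S S G => (P s).2 := fun s =>
    measurable_snd.comp (measurable_pi_apply s)
  have hins : Continuous fun X : HalfCfg S S G => Real.exp (β * inslabAction ρ X) := by
    refine Real.continuous_exp.comp (continuous_const.mul ?_)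
    unfold inslabAction
    refine continuous_finsetSum _ fun s _ => Complex.continuous_re.comp (Continuous.matrix_trace (hρ.comp ?_))
    fun_prop
  have hodd : Continuous fun tr : HalfCfg S S G × HalfCfg S S G × HalfCfg S S G =>
      Real.exp (β * oddActionU ρ tr.1 tr.2.1 tr.2.2) :=
    Real.continuous_exp.comp (continuous_const.mul (continuous_oddActionU ρ hρ))
  have hI : Measurable fun P : ZMod m → HalfCfg S S G × HalfCfg S S G => Real.exp (β * inslabAction ρ (P t).2) := by
    simpa only [Function.comp_def] using hins.measurable.comp (hm2 t)
  have hA : Measurable fun P : ZMod m → HalfCfg S S G × HalfCfg S S G =>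
      natFeature (p := featDim S Nc) β (k t) (bondVec ρ (thetaHalf (P (t + 1)).1)) := by
    simpa only [Function.comp_def] using
      ((continuous_natFeature_bondVec ρ hρ β (k t)).comp continuous_thetaHalf).measurable.comp (hm1 (t + 1))
  have hB : Measurable fun P : ZMod m → HalfCfg S S G × HalfCfg S S G =>
      natFeature (p := featDim S Nc) β (k t) (bondVec ρ (P t).1) := by
    simpa only [Function.comp_def] using (continuous_natFeature_bondVec ρ hρ β (k t)).measurable.comp (hm1 t)
  have hO : Measurable fun P : ZMod m → HalfCfg S S G × HalfCfg S S G =>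
      Real.exp (β * oddActionU ρ (P t).2 (P (t + 1)).1 (P (t + 1)).2) := by
    simpa only [Function.comp_def] using hodd.measurable.comp ((hm2 t).prodMk ((hm1 (t + 1)).prodMk (hm2 (t + 1))))
  exact (hI.mul (hA.mul hB)).mul hO

/-- ★ **`Tr K_u^m` as a sum over feature multi-indices of integrals** (`∫ Σ' = Σ' ∫`, dominated):
`diagCyclicTraceU ρ β m = Σ'_{k ∈ ℕ^{ℤ_m}} ∫ ∏_t chainFactor ρ β k P t dP`. -/
theorem diagCyclicTraceU_eq_tsum_integral (hρ : Continuous ρ) {β : ℝ} (hβ : 0 ≤ β)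
    (hρu : ∀ g, ρ g ∈ Matrix.unitaryGroup (Fin Nc) ℂ) (m : ℕ) [NeZero m] :
    diagCyclicTraceU ρ β m (S := S) (G := G) =
      ∑' k : ZMod m → ℕ, ∫ P : ZMod m → HalfCfg S S G × HalfCfg S S G, ∏ t, chainFactor ρ β k P t
        ∂(Measure.pi fun _ : ZMod m => (halfHaar S G).prod (halfHaar S G)) := by
  haveI : IsProbabilityMeasure (halfHaar S G) := by unfold halfHaar; infer_instance
  rw [diagCyclicTraceU_eq_integral_tsum ρ hβ hρu]
  obtain ⟨B, hB⟩ := exists_hasSum_abs_prod_chainFactor_le (S := S) ρ hρ hβ m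
  have hmeas : ∀ k : ZMod m → ℕ, Measurable fun P : ZMod m → HalfCfg S S G × HalfCfg S S G => ∏ t, chainFactor ρ β k P t :=
    fun k => Finset.measurable_prod _ fun t _ => measurable_chainFactor ρ hρ β k t
  have hmeas' : ∀ k : ZMod m → ℕ, Measurable fun P : ZMod m → HalfCfg S S G × HalfCfg S S G =>
      ENNReal.ofReal |∏ t, chainFactor ρ β k P t| := fun k => ENNReal.measurable_ofReal.comp (hmeas k).abs
  refine integral_tsum (fun k => (hmeas k).aestronglyMeasurable) (ne_of_lt ?_)
  -- `Σ'_k ∫⁻ ‖∏ chainFactor‖ₑ = ∫⁻ Σ'_k ofReal |∏ chainFactor| ≤ ofReal B`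
  have hswap : ∑' k : ZMod m → ℕ, ∫⁻ P, ‖∏ t, chainFactor ρ β k P t‖ₑ ∂(Measure.pi fun _ : ZMod m => (halfHaar S G).prod (halfHaar S G)) =
      ∫⁻ P, ∑' k : ZMod m → ℕ, ENNReal.ofReal |∏ t, chainFactor ρ β k P t|
        ∂(Measure.pi fun _ : ZMod m => (halfHaar S G).prod (halfHaar S G)) := by
    rw [lintegral_tsum fun k => (hmeas' k).aemeasurable]
    refine tsum_congr fun k => lintegral_congr fun P => ?_
    rw [Real.enorm_eq_ofReal_abs]
  rw [hswap]
  calc ∫⁻ P, ∑' k : ZMod m → ℕ, ENNReal.ofReal |∏ t, chainFactor ρ β k P t| ∂(Measure.pi fun _ => (halfHaar S G).prod (halfHaar S G))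
      ≤ ∫⁻ _P, ENNReal.ofReal B ∂(Measure.pi fun _ : ZMod m => (halfHaar S G).prod (halfHaar S G)) := by
        refine lintegral_mono fun P => ?_
        obtain ⟨s, hs, hsB⟩ := hB P
        rw [← ENNReal.ofReal_tsum_of_nonneg (fun k => abs_nonneg _) hs.summable, hs.tsum_eq]
        exact ENNReal.ofReal_le_ofReal hsB
    _ = ENNReal.ofReal B := by rw [lintegral_const, measure_univ, mul_one]
    _ < ⊤ := ENNReal.ofReal_lt_top

end ChainFubini

end Summit.QuantumFields.YangMills.Cruxes.DiagonalMirrorRPR.SignTwistedDiagonalTrace.WilsonDiagonal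

end
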